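import Summits.Ventures.Crystal3D.Theorems.StickyWulffConstantTextureBuildMeshV5
import HarnessLib

/-!
# TB-1: the LABELLED POLYHEDRAL MESH v6 = v5 + the REAL-COMPLETE mass count (repair Δ4 of the energy census)
# (lane T, crux `TextureLiminfV5`, stmt-Ventures-23912; repair census HOME/wulff-p2/g20/TB-D-1-g20.md + addendum Δ4 (mass), blueprint TexShadowTB `stub_LM`)

HONEST FRAMING. Venture `Summits/Ventures/Crystal3D` (cell `crystal3d-full`), route `route-Ventures-StickyWulffConstant`, helper `--supports` the
law-v5 crux `TextureLiminfV5` (stmt-Ventures-23912).  DEFINITIONS (interface v6 = v5 + ONE `Prop` field) + the level-2 composition re-typed (pure logic;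
census-free, standard axioms).  No mesh is constructed; F-C1 not moved.

WHY v6 (Δ4, found while typing `stub_LM` of the blueprint against tb-w1's mass glue `card_mul_le_volume_of_closedBalls_subset`, p713435).  The mass line
`(1 − δ)N ≤ √2·vol(texture)` is proved WITHOUT Kepler by giving every counted ball a private LATTICE cell of volume `1/√2` (…TextureBuildBarlowCellVolume):
this needs the counted ball to BE a site of a Barlow stacking all of whose sites within `2√2` are REAL balls (cells of two such balls are then disjoint,
`disjoint_cell₁₂`).  `Mesh₃.hmass`'s first disjunct `DeepAt f a` only says that the `S_f`-sites within `2√2` of `a` are TENT atoms (`Xh f` — real atoms OR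
PHANTOMS) and does not say `a ∈ S_f`: as typed it admits counted junk balls clustered near phantom sites deep in a tent, whose only private volume is
`ball(a, ½)` (`√2·π/6 ≈ 0.74 < 1` per ball) — closing that would need the Kepler bound.  REPAIR: the counted deep balls are sites of `S_f` whose `2√2`-
neighbour sites are REAL TENT ATOMS (`∈ Xh f ∩ X′`): then `DeepAt` (⇒ `SolidAt` on `closedBall(a, √2)` ⇒ tent solid a.e.) AND the lattice-cell disjointness
both hold.  Cost to the cover builder: none (deep interior balls of a grain are exactly these; the `δN` slack absorbs the rest).
* `Mesh₆ extends Mesh₅` with `hmass₆`; `gapCost` inherited; `shadowTheoremSatAtomicV5_of_risered₆_slack`, `textureBuildR₆_of_stubs`.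
-/

noncomputable section

open scoped BigOperators InnerProductSpace
open MeasureTheory

namespace Summit.Ventures.Crystal3D.Cruxes.TextureLiminf.TexShadow

open Summit.Ventures.Crystal3D Summit.Ventures.Crystal3D.Theorems

open scoped Classical in
/-- **The labelled polyhedral mesh, v6**: `Mesh₅` + the real-complete mass count. -/
structure Mesh₆ {C R₀ : ℝ} {N : ℕ} {x : Fin N → E3} (rc : RiseredCover C R₀ N x) (δ : ℝ) extends Mesh₅ rc δ where
  /-- (Δ4) REAL-COMPLETE MASS: at least `(1 − δ)N` balls are EITHER sites of their grain's stacking all of whose sites within `2√2` are real tent atoms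
  (`∈ Xh f` and `∈ X′`), OR away from the free zone and locally perfect; and their `√2`-balls lie in the territory or the deep prism parts of the grain -/
  hmass₆ : (1 - δ) * (N : ℝ) ≤
    ((Finset.univ.filter fun i : Fin rc.N' => ∃ f,
      ((rc.x' i ∈ rc.S f ∧ ∀ b ∈ rc.S f, dist (rc.x' i) b ≤ 2 * Real.sqrt 2 → b ∈ (rc.tent f).Xh ∧ b ∈ rc.X') ∨
        (Disjoint (Metric.closedBall (rc.x' i) (Real.sqrt 2)) (rc.tent f).U ∧ rc.LocPerfect (rc.x' i))) ∧
      Metric.closedBall (rc.x' i) (Real.sqrt 2) ⊆ (⋃ j, polytope (HD f j)) ∪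
        (⋃ k ∈ (Finset.univ.filter fun k => fk k = f), (closure (polytope (HP k)) ∩ {z | rc.height k z ≤ -1})) ∪
        (⋃ k ∈ (Finset.univ.filter fun k => gk k = f), (closure (polytope (HP k)) ∩ {z | (rc.cell k).h + 1 ≤ rc.height k z}))).card : ℝ)

namespace Mesh₆

variable {C R₀ : ℝ} {N : ℕ} {x : Fin N → E3} {rc : RiseredCover C R₀ N x} {δ : ℝ}

/-- the gap cost (inherited) -/
def gapCost (μ : Mesh₆ rc δ) : ℝ := μ.toMesh₅.gapCost

/-- `gapCost` is that of the underlying v5 / v3 mesh. -/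
theorem gapCost_eq (μ : Mesh₆ rc δ) : μ.gapCost = μ.toMesh₃.gapCost := rfl

end Mesh₆

/-! ## The level-2 composition of record (mesh v6, slack form) -/

/-- **THE LEVEL-2 COMPOSITION over risered cover + mesh v6, WITH SLACK** (adhesion hypothesis arbitrary). -/
theorem shadowTheoremSatAtomicV5_of_risered₆_slack {Adh : Prop}
    (hcover : BarlowResolution → Adh →
      ∀ C R₀ : ℝ, 1 ≤ R₀ → ∀ K δ θ : ℝ, 0 < δ → 0 < θ → ∃ N₀ : ℕ, ∀ N : ℕ, N₀ ≤ N → ∀ x : Fin N → E3, IsUnitPacking x →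
        IsSaturated x → 6 * (N : ℝ) - (numContacts x : ℝ) ≤ K * (N : ℝ) ^ ((2 : ℝ) / 3) →
        ∃ (rc : RiseredCover C R₀ N x) (μ : Mesh₆ rc δ),
          rc.tilingLoss₂ + rc.rimSum + μ.gapCost ≤ θ * (N : ℝ) ^ ((2 : ℝ) / 3) + rc.unownedSlack₃)
    (henergy : PolytopeCalculus → BarlowFreeCertificate →
      ∀ (C R₀ : ℝ) (N : ℕ) (x : Fin N → E3) (δ : ℝ) (rc : RiseredCover C R₀ N x) (μ : Mesh₆ rc δ),
        ∃ (n : ℕ) (G : Fin n → Set E3) (A : Fin n → (E3 ≃ₗᵢ[ℝ] E3)) (c : Fin n → Fin n → ℝ) (m : Fin n → Fin n → E3),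
          IsTexture (13 / 25) (1 / 2) n G A c m ∧ (1 - δ) * (N : ℝ) ≤ Real.sqrt 2 * vol n G ∧
          energy n G A c m ≤ rc.tentBudget + rc.chargeSum + rc.riserSum + μ.gapCost) :
    BarlowResolution → Adh → BilayerWallV5 → PolytopeCalculus → BarlowFreeCertificate → ShadowTheoremSatAtomicV5 := by
  intro hres hadh hBW hpoly hfree _hG _hC _hNRG _hSL K δ θ hδ hθ
  obtain ⟨C, R₀, hR₀, hW⟩ := hBW
  obtain ⟨N₀, hN₀⟩ := hcover hres hadh C R₀ hR₀ K δ θ hδ hθ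
  refine ⟨N₀, fun N hN x hx hsat hK => ?_⟩
  obtain ⟨rc, μ, hslack⟩ := hN₀ N hN x hx hsat hK
  obtain ⟨n, G, A, c, m, hT, hvol, hEn⟩ := henergy hpoly hfree C R₀ N x δ rc μ
  refine ⟨n, G, A, c, m, hT, hvol, ?_⟩
  have hdisc := rc.tentBudget_add_chargeSum_le₃_slack hR₀ hW
  linarith

/-- **THE COMPOSITION OF RECORD (mesh v6)**: TB-cover v6 + TB-energy v6 ⇒ the registered shape of `stub_textureBuild`. -/
theorem textureBuildR₆_of_stubs {Adh : Prop}
    (hcover : BarlowResolution → Adh →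
      ∀ C R₀ : ℝ, 1 ≤ R₀ → ∀ K δ θ : ℝ, 0 < δ → 0 < θ → ∃ N₀ : ℕ, ∀ N : ℕ, N₀ ≤ N → ∀ x : Fin N → E3, IsUnitPacking x →
        IsSaturated x → 6 * (N : ℝ) - (numContacts x : ℝ) ≤ K * (N : ℝ) ^ ((2 : ℝ) / 3) →
        ∃ (rc : RiseredCover C R₀ N x) (μ : Mesh₆ rc δ),
          rc.tilingLoss₂ + rc.rimSum + μ.gapCost ≤ θ * (N : ℝ) ^ ((2 : ℝ) / 3) + rc.unownedSlack₃)
    (henergy : PolytopeCalculus → BarlowFreeCertificate →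
      ∀ (C R₀ : ℝ) (N : ℕ) (x : Fin N → E3) (δ : ℝ) (rc : RiseredCover C R₀ N x) (μ : Mesh₆ rc δ),
        ∃ (n : ℕ) (G : Fin n → Set E3) (A : Fin n → (E3 ≃ₗᵢ[ℝ] E3)) (c : Fin n → Fin n → ℝ) (m : Fin n → Fin n → E3),
          IsTexture (13 / 25) (1 / 2) n G A c m ∧ (1 - δ) * (N : ℝ) ≤ Real.sqrt 2 * vol n G ∧
          energy n G A c m ≤ rc.tentBudget + rc.chargeSum + rc.riserSum + μ.gapCost) :
    BarlowResolution → Adh → BilayerWallV5 → PolytopeCalculus → BarlowFreeCertificate → ShadowTheoremSatV5 :=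
  textureBuild_of_atomic (shadowTheoremSatAtomicV5_of_risered₆_slack hcover henergy)

/-! ## The same with the wall-law regime `1 ≤ R₀` handed to the energy stub (Δ5: the cut-level plumbing needs `wallSlice ⊆ cyl`) -/

/-- **THE LEVEL-2 COMPOSITION over risered cover + mesh v6, WITH SLACK, energy stub in the regime `1 ≤ R₀`** (the cover stub is only ever
invoked with `1 ≤ R₀`, so the energy stub may assume it: free for the composition, needed by the cut-level plumbing of the blueprint). -/
theorem shadowTheoremSatAtomicV5_of_risered₆R_slack {Adh : Prop}
    (hcover : BarlowResolution → Adh →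
      ∀ C R₀ : ℝ, 1 ≤ R₀ → ∀ K δ θ : ℝ, 0 < δ → 0 < θ → ∃ N₀ : ℕ, ∀ N : ℕ, N₀ ≤ N → ∀ x : Fin N → E3, IsUnitPacking x →
        IsSaturated x → 6 * (N : ℝ) - (numContacts x : ℝ) ≤ K * (N : ℝ) ^ ((2 : ℝ) / 3) →
        ∃ (rc : RiseredCover C R₀ N x) (μ : Mesh₆ rc δ),
          rc.tilingLoss₂ + rc.rimSum + μ.gapCost ≤ θ * (N : ℝ) ^ ((2 : ℝ) / 3) + rc.unownedSlack₃)
    (henergy : PolytopeCalculus → BarlowFreeCertificate →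
      ∀ (C R₀ : ℝ), 1 ≤ R₀ → ∀ (N : ℕ) (x : Fin N → E3) (δ : ℝ) (rc : RiseredCover C R₀ N x) (μ : Mesh₆ rc δ),
        ∃ (n : ℕ) (G : Fin n → Set E3) (A : Fin n → (E3 ≃ₗᵢ[ℝ] E3)) (c : Fin n → Fin n → ℝ) (m : Fin n → Fin n → E3),
          IsTexture (13 / 25) (1 / 2) n G A c m ∧ (1 - δ) * (N : ℝ) ≤ Real.sqrt 2 * vol n G ∧
          energy n G A c m ≤ rc.tentBudget + rc.chargeSum + rc.riserSum + μ.gapCost) :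
    BarlowResolution → Adh → BilayerWallV5 → PolytopeCalculus → BarlowFreeCertificate → ShadowTheoremSatAtomicV5 := by
  intro hres hadh hBW hpoly hfree _hG _hC _hNRG _hSL K δ θ hδ hθ
  obtain ⟨C, R₀, hR₀, hW⟩ := hBW
  obtain ⟨N₀, hN₀⟩ := hcover hres hadh C R₀ hR₀ K δ θ hδ hθ
  refine ⟨N₀, fun N hN x hx hsat hK => ?_⟩
  obtain ⟨rc, μ, hslack⟩ := hN₀ N hN x hx hsat hK
  obtain ⟨n, G, A, c, m, hT, hvol, hEn⟩ := henergy hpoly hfree C R₀ hR₀ N x δ rc μ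
  refine ⟨n, G, A, c, m, hT, hvol, ?_⟩
  have hdisc := rc.tentBudget_add_chargeSum_le₃_slack hR₀ hW
  linarith

/-- **THE COMPOSITION OF RECORD (mesh v6, regime `1 ≤ R₀`)**: TB-cover v6 + TB-energy v6 (with `1 ≤ R₀`) ⇒ the registered shape of `stub_textureBuild`. -/
theorem textureBuildR₆R_of_stubs {Adh : Prop}
    (hcover : BarlowResolution → Adh →
      ∀ C R₀ : ℝ, 1 ≤ R₀ → ∀ K δ θ : ℝ, 0 < δ → 0 < θ → ∃ N₀ : ℕ, ∀ N : ℕ, N₀ ≤ N → ∀ x : Fin N → E3, IsUnitPacking x →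
        IsSaturated x → 6 * (N : ℝ) - (numContacts x : ℝ) ≤ K * (N : ℝ) ^ ((2 : ℝ) / 3) →
        ∃ (rc : RiseredCover C R₀ N x) (μ : Mesh₆ rc δ),
          rc.tilingLoss₂ + rc.rimSum + μ.gapCost ≤ θ * (N : ℝ) ^ ((2 : ℝ) / 3) + rc.unownedSlack₃)
    (henergy : PolytopeCalculus → BarlowFreeCertificate →
      ∀ (C R₀ : ℝ), 1 ≤ R₀ → ∀ (N : ℕ) (x : Fin N → E3) (δ : ℝ) (rc : RiseredCover C R₀ N x) (μ : Mesh₆ rc δ),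
        ∃ (n : ℕ) (G : Fin n → Set E3) (A : Fin n → (E3 ≃ₗᵢ[ℝ] E3)) (c : Fin n → Fin n → ℝ) (m : Fin n → Fin n → E3),
          IsTexture (13 / 25) (1 / 2) n G A c m ∧ (1 - δ) * (N : ℝ) ≤ Real.sqrt 2 * vol n G ∧
          energy n G A c m ≤ rc.tentBudget + rc.chargeSum + rc.riserSum + μ.gapCost) :
    BarlowResolution → Adh → BilayerWallV5 → PolytopeCalculus → BarlowFreeCertificate → ShadowTheoremSatV5 :=
  textureBuild_of_atomic (shadowTheoremSatAtomicV5_of_risered₆R_slack hcover henergy)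

end Summit.Ventures.Crystal3D.Cruxes.TextureLiminf.TexShadow

end
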